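import Literature.Computability.QuantumComplexity.TidyBlock
import HarnessLib

/-!
# Tidy subroutines computing a FUNCTION: compute–copy the answer register–uncompute

Topic `Literature/Computability/QuantumComplexity`, the function-valued companion of `TidyBlock.lean`
(BBBV 1997, Thm. 4.14 for DECIDERS: one answer bit). When a bounded-error quantum subroutine computes a
many-bit value — Regev's iterative step (Regev 2009, Lemma 3.3: the quantum sampler of Lemma 3.14 calls
the `CVP` procedure of Lemma 3.4, whose answer is a coefficient VECTOR, "using the CVP oracle, we can
recover `x` … this allows us to uncompute the first register"), Shor-type arithmetic subroutines — it
must be called ONCE per value, not once per bit: the error of a tidy call is paid per call, and the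
number of calls must not grow with the bit length of the answer. This file builds the tidy block around
a subroutine `S` on `k + d` wires writing an `ℓ`-bit answer on its first `ℓ` wires:

  copy the query `q` into `S`'s register · run `S` · CNOT its first `ℓ` wires onto the answer register
  · run `S⁻¹` · uncopy

(Bennett 1973 / BBBV 1997, proof of Thm. 4.14: "run, copy the answer to another track, reverse"), and
proves the weighted form of BBBV's estimate for it:

* layout `TidyBlockFn.W k ℓ d = k + ℓ + (k + d)` (query, answer register, subroutine register),
  `reg q a f`, `query`, `answer`; programs `copyOps`, `ansOps`, the block `tidyCirc S`
  (`tidyCirc_isOracleFree`), classical semantics (`revEval_copyOps`, `revEval_ansOps`);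
* the ideal gate `idealFn f : |q, a, g⟩ ↦ |q, a ⊕ f(q), g⟩` of a function `f : {0,1}ᵏ → {0,1}^ℓ`
  (`idealFn_mulVec_basisState`, a basis involution);
* `errFn f S q` — the Born weight of the outputs of `S` on `|q 0^d⟩` (`TidyBlock.ψD`) whose answer register
  differs from `f q`; `queryWeight ψ q = Σ_a |ψ(q, a, 0…0)|²` (the copy semantics `TidyBlock.xorOn/mask`, the
  clean content `TidyBlock.zf` and `TidyBlock.norm_sub_sq_le` are reused from the one-bit file);
* **`normSq_tidyCirc_sub_idealFn_le`** — on every input whose wires `≥ k + ℓ` read `0`,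
  `‖T ψ − U_f ψ‖₂² ≤ 4 Σ_q errFn(q) · w_ψ(q)`: per query `q` the error is
  `Σ_{g wrong} ψ_S(g) (Σ_a c_a(|a ⊕ ans g⟩ − |a ⊕ f q⟩)) ⊗ S⁻¹|g⟩`, orthogonal across `g` and across `q`,
  and `‖Σ_a c_a |a ⊕ u⟩ − Σ_a c_a |a ⊕ v⟩‖² ≤ 4‖c‖²` (`normSq_sectorErr_le`).

Everything is proved; no named fact is introduced.

## References

* C. H. Bennett, E. Bernstein, G. Brassard, U. Vazirani, *Strengths and weaknesses of quantum
  computing*, SIAM J. Comput. 26 (1997) 1510–1523, §4 ("copy `f(x)` into safe storage, and then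
  uncompute"), Thm. 4.14 and its proof [BennettBernsteinBrassardVazirani1997].
* C. H. Bennett, *Logical reversibility of computation*, IBM J. Res. Develop. 17 (1973), §2
  (compute – copy output – uncompute) [Bennett1973].
* O. Regev, *On lattices, learning with errors, random linear codes, and cryptography*, J. ACM 56
  (2009), art. 34, Lemma 3.3 and Lemma 3.14 (proof) [Regev2009].
* M. A. Nielsen, I. L. Chuang, *Quantum Computation and Quantum Information*, CUP 2010, §3.2.5
  (uncomputation) [NielsenChuang2010].
-/

noncomputable section

namespace Literature.Computability.QuantumComplexity

namespace TidyBlockFn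

open Cryptography Matrix

variable {k ℓ d : ℕ}

/-! ### Layout -/

/-- The width of the tidy block: query `k`, answer register `ℓ`, subroutine register `k + d`.
[folklore] -/
abbrev W (k ℓ d : ℕ) : ℕ := k + ℓ + (k + d)

/-- Query wire `i`. [folklore] -/
def qW (i : Fin k) : Fin (W k ℓ d) := Fin.castAdd (k + d) (Fin.castAdd ℓ i)

/-- Answer wire `i`. [folklore] -/
def aW (i : Fin ℓ) : Fin (W k ℓ d) := Fin.castAdd (k + d) (Fin.natAdd k i)

/-- The subroutine's register: wires `k + ℓ …`. [folklore] -/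
def dE (k ℓ d : ℕ) : Fin (k + d) ↪ Fin (W k ℓ d) := Fin.natAddEmb (k + ℓ)

/-- The placement of the ideal gate: the first `k + ℓ` wires. [folklore] -/
def oE (k ℓ d : ℕ) : Fin (k + ℓ) ↪ Fin (W k ℓ d) := Fin.castAddEmb (k + d)

/-- Layout bookkeeping. [folklore] -/
theorem val_qW (i : Fin k) : ((qW (ℓ := ℓ) (d := d) i : Fin (W k ℓ d)) : ℕ) = i := rfl

/-- Layout bookkeeping. [folklore] -/
theorem val_aW (i : Fin ℓ) : ((aW (k := k) (d := d) i : Fin (W k ℓ d)) : ℕ) = k + i := rfl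

/-- Layout bookkeeping. [folklore] -/
theorem val_dE (j : Fin (k + d)) : ((dE k ℓ d j : Fin (W k ℓ d)) : ℕ) = k + ℓ + j := rfl

/-- The register with query `q`, answer register `a` and subroutine-register content `f`. [folklore] -/
def reg (q : QReg k) (a : QReg ℓ) (f : QReg (k + d)) : QReg (W k ℓ d) :=
  Fin.append (Fin.append q a) f

/-- Layout bookkeeping. [folklore] -/
@[simp] theorem reg_qW (q : QReg k) (a : QReg ℓ) (f : QReg (k + d)) (i : Fin k) : reg q a f (qW i) = q i := by
  simp [reg, qW]

/-- Layout bookkeeping. [folklore] -/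
@[simp] theorem reg_aW (q : QReg k) (a : QReg ℓ) (f : QReg (k + d)) (i : Fin ℓ) : reg q a f (aW i) = a i := by
  simp [reg, aW]

/-- Layout bookkeeping. [folklore] -/
@[simp] theorem reg_dE (q : QReg k) (a : QReg ℓ) (f : QReg (k + d)) (j : Fin (k + d)) : reg q a f (dE k ℓ d j) = f j := by
  simp [reg, dE]

/-- Layout bookkeeping. [folklore] -/
theorem reg_comp_dE (q : QReg k) (a : QReg ℓ) (f : QReg (k + d)) : reg q a f ∘ dE k ℓ d = f :=
  funext fun j => reg_dE q a f j

/-- The query content of a register. [folklore] -/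
def query (z : QReg (W k ℓ d)) : QReg k := fun i => z (qW i)

/-- The answer content of a register. [folklore] -/
def answer (z : QReg (W k ℓ d)) : QReg ℓ := fun i => z (aW i)

/-- Layout bookkeeping. [folklore] -/
@[simp] theorem query_reg (q : QReg k) (a : QReg ℓ) (f : QReg (k + d)) : query (reg q a f) = q :=
  funext fun i => reg_qW q a f i

/-- Layout bookkeeping. [folklore] -/
@[simp] theorem answer_reg (q : QReg k) (a : QReg ℓ) (f : QReg (k + d)) : answer (reg q a f) = a :=
  funext fun i => reg_aW q a f i

/-- Trichotomy of wires: query wire, answer wire, or subroutine wire. [folklore] -/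
theorem wire_cases (w : Fin (W k ℓ d)) :
    (∃ i : Fin k, w = qW i) ∨ (∃ i : Fin ℓ, w = aW i) ∨ ∃ j : Fin (k + d), w = dE k ℓ d j := by
  rcases Nat.lt_or_ge (w : ℕ) k with h | h
  · exact Or.inl ⟨⟨w, h⟩, Fin.ext rfl⟩
  · rcases Nat.lt_or_ge (w : ℕ) (k + ℓ) with h' | h'
    · exact Or.inr (Or.inl ⟨⟨(w : ℕ) - k, by omega⟩, Fin.ext (by rw [val_aW]; simp only; omega)⟩)
    · exact Or.inr (Or.inr ⟨⟨(w : ℕ) - (k + ℓ), by have := w.isLt; unfold W at this; omega⟩,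
        Fin.ext (by rw [val_dE]; simp only; omega)⟩)

/-- A register is determined by its three parts. [folklore] -/
theorem reg_eta (z : QReg (W k ℓ d)) : reg (query z) (answer z) (z ∘ dE k ℓ d) = z := by
  funext w
  rcases wire_cases w with ⟨i, rfl⟩ | ⟨i, rfl⟩ | ⟨j, rfl⟩
  · rw [reg_qW]; rfl
  · rw [reg_aW]; rfl
  · rw [reg_dE]; rfl

/-- Layout bookkeeping. [folklore] -/
theorem qW_ne_aW (i : Fin k) (i' : Fin ℓ) : (qW (d := d) i : Fin (W k ℓ d)) ≠ aW i' := by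
  intro h; have := congrArg Fin.val h; rw [val_qW, val_aW] at this; have := i.isLt; omega

/-- Layout bookkeeping. [folklore] -/
theorem qW_ne_dE (i : Fin k) (j : Fin (k + d)) : (qW (ℓ := ℓ) i : Fin (W k ℓ d)) ≠ dE k ℓ d j := by
  intro h; have := congrArg Fin.val h; rw [val_qW, val_dE] at this; have := i.isLt; omega

/-- Layout bookkeeping. [folklore] -/
theorem aW_ne_dE (i : Fin ℓ) (j : Fin (k + d)) : (aW (k := k) i : Fin (W k ℓ d)) ≠ dE k ℓ d j := by
  intro h; have := congrArg Fin.val h; rw [val_aW, val_dE] at this; have := i.isLt; omega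

/-- Layout bookkeeping. [folklore] -/
theorem aW_notMem_range_dE (i : Fin ℓ) : (aW (k := k) i : Fin (W k ℓ d)) ∉ Set.range (dE k ℓ d) := by
  rintro ⟨j, hj⟩; exact aW_ne_dE i j hj.symm

/-- Layout bookkeeping. [folklore] -/
theorem qW_notMem_range_dE (i : Fin k) : (qW (ℓ := ℓ) i : Fin (W k ℓ d)) ∉ Set.range (dE k ℓ d) := by
  rintro ⟨j, hj⟩; exact qW_ne_dE i j hj.symm

/-- Two registers agree off the subroutine register iff they have the same query and answer. [folklore] -/
theorem agreeOff_dE_iff (z c : QReg (W k ℓ d)) :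
    AgreeOff (dE k ℓ d) z c ↔ query z = query c ∧ answer z = answer c := by
  constructor
  · intro h
    exact ⟨funext fun i => h _ (qW_notMem_range_dE i), funext fun i => h _ (aW_notMem_range_dE i)⟩
  · rintro ⟨hq, ha⟩ w hw
    rcases wire_cases w with ⟨i, rfl⟩ | ⟨i, rfl⟩ | ⟨j, rfl⟩
    · exact congrFun hq i
    · exact congrFun ha i
    · exact absurd ⟨j, rfl⟩ hw

/-- Layout bookkeeping. [folklore] -/
theorem agreeOff_reg_iff (z : QReg (W k ℓ d)) (q : QReg k) (a : QReg ℓ) (g : QReg (k + d)) :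
    AgreeOff (dE k ℓ d) z (reg q a g) ↔ query z = q ∧ answer z = a := by
  rw [agreeOff_dE_iff, query_reg, answer_reg]

/-- Writing the subroutine register of `reg q a g`. [folklore] -/
theorem extend_dE_reg (f : QReg (k + d)) (q : QReg k) (a : QReg ℓ) (g : QReg (k + d)) :
    Function.extend (dE k ℓ d) f (reg q a g) = reg q a f := by
  rw [extend_eq_iff]
  exact ⟨reg_comp_dE q a f, (agreeOff_reg_iff _ q a g).2 ⟨query_reg q a f, answer_reg q a f⟩⟩

/-- Updating an answer wire. [folklore] -/
theorem update_reg_aW (q : QReg k) (a : QReg ℓ) (f : QReg (k + d)) (i : Fin ℓ) (v : Bool) :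
    Function.update (reg q a f) (aW i) v = reg q (Function.update a i v) f := by
  funext w
  rcases eq_or_ne w (aW i) with rfl | hw
  · rw [Function.update_self, reg_aW, Function.update_self]
  · rw [Function.update_of_ne hw]
    rcases wire_cases w with ⟨i', rfl⟩ | ⟨i', rfl⟩ | ⟨j, rfl⟩
    · rw [reg_qW, reg_qW]
    · rw [reg_aW, reg_aW, Function.update_of_ne]
      intro hii; exact hw (by rw [hii])
    · rw [reg_dE, reg_dE]

/-- Updating a subroutine wire. [folklore] -/
theorem update_reg_dE (q : QReg k) (a : QReg ℓ) (f : QReg (k + d)) (j : Fin (k + d)) (v : Bool) :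
    Function.update (reg q a f) (dE k ℓ d j) v = reg q a (Function.update f j v) := by
  funext w
  rcases eq_or_ne w (dE k ℓ d j) with rfl | hw
  · rw [Function.update_self, reg_dE, Function.update_self]
  · rw [Function.update_of_ne hw]
    rcases wire_cases w with ⟨i, rfl⟩ | ⟨i, rfl⟩ | ⟨j', rfl⟩
    · rw [reg_qW, reg_qW]
    · rw [reg_aW, reg_aW]
    · rw [reg_dE, reg_dE, Function.update_of_ne]
      intro hjj; exact hw (by rw [hjj])

/-- `reg` is injective. [folklore] -/
theorem reg_injective_iff (q q' : QReg k) (a a' : QReg ℓ) (f f' : QReg (k + d)) :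
    reg q a f = reg q' a' f' ↔ q = q' ∧ a = a' ∧ f = f' := by
  constructor
  · intro h
    refine ⟨?_, ?_, ?_⟩
    · rw [← query_reg q a f, h, query_reg]
    · rw [← answer_reg q a f, h, answer_reg]
    · rw [← reg_comp_dE q a f, h, reg_comp_dE]
  · rintro ⟨rfl, rfl, rfl⟩; rfl

/-- The three parts as coordinates: `(q, a, f) ↦ reg q a f` is a bijection. [folklore] -/
def regEquiv (k ℓ d : ℕ) : QReg k × QReg ℓ × QReg (k + d) ≃ QReg (W k ℓ d) where
  toFun p := reg p.1 p.2.1 p.2.2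
  invFun z := (query z, answer z, z ∘ dE k ℓ d)
  left_inv p := by simp [reg_comp_dE]
  right_inv z := reg_eta z

/-- Sums over the register split over the three parts. [folklore] -/
theorem sum_eq_sum_sum_sum {M : Type*} [AddCommMonoid M] (F : QReg (W k ℓ d) → M) :
    ∑ z, F z = ∑ q : QReg k, ∑ a : QReg ℓ, ∑ f : QReg (k + d), F (reg q a f) := by
  rw [← Equiv.sum_comp (regEquiv k ℓ d), Fintype.sum_prod_type]
  refine Finset.sum_congr rfl fun q _ => ?_
  rw [Fintype.sum_prod_type]
  rfl

/-! ### The tidy block -/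

/-- The copy operations: CNOT from query wire `i` onto the subroutine's wire `i`. [cite: BennettBernsteinBrassardVazirani1997, §4 (copy into safe storage)] -/
def copyOpsOf (l : List (Fin k)) : List (RevOp (W k ℓ d)) :=
  l.map fun i => RevOp.cnot (qW i) (dE k ℓ d (Fin.castAdd d i)) (qW_ne_dE i _)

/-- All the copy operations. [folklore] -/
def copyOps (k ℓ d : ℕ) : List (RevOp (W k ℓ d)) := copyOpsOf (List.finRange k)

/-- **The answer register of a subroutine-register content**: its first `ℓ` wires. Convention for the
junk regime `ℓ > k + d` (an answer register longer than the whole subroutine register, never the case in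
use): the missing bits read `false`, no gate copies them, and `errFn` below then counts as wrong every
output on a query whose ideal answer has a `true` bit beyond the register. [folklore] -/
def ans (f : QReg (k + d)) : QReg ℓ := fun i => if h : (i : ℕ) < k + d then f ⟨i, h⟩ else false

/-- The copy of answer bit `i`: CNOT from the subroutine's wire `i` onto answer wire `i` (nothing if the
subroutine has no such wire). [cite: BennettBernsteinBrassardVazirani1997, Thm. 4.14 (proof: copying the answer to another track)] -/
def ansOp (i : Fin ℓ) : List (RevOp (W k ℓ d)) :=
  if h : (i : ℕ) < k + d then [RevOp.cnot (dE k ℓ d ⟨i, h⟩) (aW i) (aW_ne_dE _ _).symm] else []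

/-- The answer copies along a list of answer indices. [folklore] -/
def ansOpsOf (l : List (Fin ℓ)) : List (RevOp (W k ℓ d)) := l.flatMap ansOp

/-- **The answer copy**: all `ℓ` answer bits. [folklore] -/
def ansOps (k ℓ d : ℕ) : List (RevOp (W k ℓ d)) := ansOpsOf (List.finRange ℓ)

/-- **The tidy block** around the subroutine `S`: copy the query, run `S`, copy its answer register onto
the answer wires, run `S⁻¹`, uncopy. [cite: BennettBernsteinBrassardVazirani1997, Thm. 4.14 (proof)] -/
def tidyGates (S : QCircuit cliffordT (k + d)) : List (QGate cliffordT (W k ℓ d)) :=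
  revCompile (copyOps k ℓ d) ++ ((mapWires (dE k ℓ d) S).gates ++ (revCompile (ansOps k ℓ d) ++
    ((mapWires (dE k ℓ d) S.inv).gates ++ revCompile (copyOps k ℓ d))))

/-- The tidy block as a circuit on `(k + ℓ) + (k + d)` wires. [cite: BennettBernsteinBrassardVazirani1997, Thm. 4.14] -/
def tidyCirc (S : QCircuit cliffordT (k + d)) : QCircuit cliffordT (k + ℓ + (k + d)) := ⟨tidyGates S⟩

/-- The tidy block is oracle-free if the subroutine is. [folklore] -/
theorem tidyCirc_isOracleFree {S : QCircuit cliffordT (k + d)} (hS : S.IsOracleFree) :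
    (tidyCirc (ℓ := ℓ) S).IsOracleFree := by
  intro g hg
  simp only [tidyCirc, tidyGates, List.mem_append] at hg
  rcases hg with hg | hg | hg | hg | hg
  · exact revCompile_isOracleFree _ g hg
  · exact isOracleFree_mapWires _ hS g hg
  · exact revCompile_isOracleFree _ g hg
  · exact isOracleFree_mapWires _ (QCircuit.inv_isOracleFree hS) g hg
  · exact revCompile_isOracleFree _ g hg

/-! ### Classical semantics of the copy and of the answer copy -/

/-- The copy operations act by `xorOn` on the subroutine register. [folklore] -/
theorem revEval_copyOpsOf (l : List (Fin k)) (q : QReg k) (a : QReg ℓ) (f : QReg (k + d)) :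
    revEval (copyOpsOf (ℓ := ℓ) (d := d) l) (reg q a f) = reg q a (TidyBlock.xorOn l q f) := by
  induction l generalizing f with
  | nil => rfl
  | cons i l ih =>
    change revEval (copyOpsOf l) (RevOp.eval _ (reg q a f)) = _
    rw [RevOp.eval, reg_qW, reg_dE, update_reg_dE]
    exact ih _

/-- **The copy on a register**: XOR the padded query into the subroutine register. [folklore] -/
theorem revEval_copyOps (q : QReg k) (a : QReg ℓ) (f : QReg (k + d)) :
    revEval (copyOps k ℓ d) (reg q a f) = reg q a (fun j => f j ^^ padInput q d j) := by
  rw [copyOps, revEval_copyOpsOf, TidyBlock.xorOn_eq_of_nodup (List.nodup_finRange k), TidyBlock.mask_finRange]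

/-- The copy on a clean register writes the padded query. [folklore] -/
theorem revEval_copyOps_zero (q : QReg k) (a : QReg ℓ) :
    revEval (copyOps k ℓ d) (reg q a fun _ => false) = reg q a (padInput q d) := by
  rw [revEval_copyOps]; simp

/-- The copy on a copied register cleans it. [folklore] -/
theorem revEval_copyOps_padInput (q : QReg k) (a : QReg ℓ) :
    revEval (copyOps k ℓ d) (reg q a (padInput q d)) = reg q a fun _ => false := by
  rw [revEval_copyOps]; simp

/-- The answer copies along `l`, as a map of the answer register. [folklore] -/
def xorA (f : QReg (k + d)) : List (Fin ℓ) → QReg ℓ → QReg ℓ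
  | [], a => a
  | i :: l, a => xorA f l (Function.update a i (a i ^^ ans f i))

/-- **The answer copy of bit `i` on a register.** [folklore] -/
theorem revEval_ansOp (q : QReg k) (a : QReg ℓ) (f : QReg (k + d)) (i : Fin ℓ) :
    revEval (ansOp (k := k) (d := d) i) (reg q a f) = reg q (Function.update a i (a i ^^ ans f i)) f := by
  unfold ansOp ans
  split_ifs with h
  · change revEval [] (RevOp.eval _ (reg q a f)) = _
    rw [revEval, RevOp.eval, reg_aW, reg_dE, update_reg_aW]
  · rw [revEval, Bool.xor_false, Function.update_eq_self]

/-- The answer copies along a list act by `xorA`. [folklore] -/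
theorem revEval_ansOpsOf (q : QReg k) (f : QReg (k + d)) : ∀ (l : List (Fin ℓ)) (a : QReg ℓ),
    revEval (ansOpsOf (k := k) (d := d) l) (reg q a f) = reg q (xorA f l a) f
  | [], a => rfl
  | i :: l, a => by
    rw [ansOpsOf, List.flatMap_cons, revEval_append, revEval_ansOp, ← ansOpsOf, revEval_ansOpsOf q f l]
    rfl

/-- `xorA` along a duplicate-free list XORs the indicated answer bits. [folklore] -/
theorem xorA_eq_of_nodup (f : QReg (k + d)) : ∀ {l : List (Fin ℓ)}, l.Nodup → ∀ a : QReg ℓ,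
    xorA f l a = fun i => a i ^^ (if i ∈ l then ans f i else false)
  | [], _, a => funext fun i => by simp [xorA]
  | i :: l, hl, a => by
    rw [List.nodup_cons] at hl
    rw [xorA, xorA_eq_of_nodup f hl.2]
    funext j
    by_cases hj : j = i
    · subst hj
      simp only [Function.update_self, List.mem_cons, true_or, if_true, if_neg hl.1, Bool.xor_false]
    · rw [Function.update_of_ne hj]
      simp only [List.mem_cons, hj, false_or]

/-- **The answer copy on a register**: XOR the subroutine's answer register onto the answer wires.
[cite: BennettBernsteinBrassardVazirani1997, Thm. 4.14 (proof: copy the answer)] -/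
theorem revEval_ansOps (q : QReg k) (a : QReg ℓ) (f : QReg (k + d)) :
    revEval (ansOps k ℓ d) (reg q a f) = reg q (fun i => a i ^^ ans f i) f := by
  rw [ansOps, revEval_ansOpsOf, xorA_eq_of_nodup f (List.nodup_finRange ℓ)]
  simp

/-! ### The pieces of the tidy block as matrices -/

section Pieces

variable (S : QCircuit cliffordT (k + d))

/-- The matrix of the copy. [folklore] -/
abbrev Mc (k ℓ d : ℕ) : Matrix (QReg (W k ℓ d)) (QReg (W k ℓ d)) ℂ :=
  (⟨revCompile (copyOps k ℓ d)⟩ : QCircuit cliffordT (W k ℓ d)).toMatrix 0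

/-- The matrix of the answer copy. [folklore] -/
abbrev Ma (k ℓ d : ℕ) : Matrix (QReg (W k ℓ d)) (QReg (W k ℓ d)) ℂ :=
  (⟨revCompile (ansOps k ℓ d)⟩ : QCircuit cliffordT (W k ℓ d)).toMatrix 0

/-- The placed subroutine. [folklore] -/
abbrev Ud (S : QCircuit cliffordT (k + d)) : Matrix (QReg (W k ℓ d)) (QReg (W k ℓ d)) ℂ :=
  (mapWires (dE k ℓ d) S).toMatrix 0

/-- The placed inverse subroutine. [folklore] -/
abbrev Vd (S : QCircuit cliffordT (k + d)) : Matrix (QReg (W k ℓ d)) (QReg (W k ℓ d)) ℂ :=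
  (mapWires (dE k ℓ d) S.inv).toMatrix 0

/-- The target of the ideal gate of `f`: the answer register XORed with `f q`. [folklore] -/
def fnTarget (f : QReg k → QReg ℓ) (z : QReg (W k ℓ d)) : QReg (W k ℓ d) :=
  reg (query z) (fun i => answer z i ^^ f (query z) i) (z ∘ dE k ℓ d)

/-- On a register the target XORs `f q` into the answer. [folklore] -/
theorem fnTarget_reg (f : QReg k → QReg ℓ) (q : QReg k) (a : QReg ℓ) (g : QReg (k + d)) :
    fnTarget f (reg q a g) = reg q (fun i => a i ^^ f q i) g := by
  rw [fnTarget, query_reg, answer_reg, reg_comp_dE]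

/-- The target map is an involution. [folklore] -/
theorem fnTarget_fnTarget (f : QReg k → QReg ℓ) (z : QReg (W k ℓ d)) : fnTarget f (fnTarget f z) = z := by
  conv_rhs => rw [← reg_eta z]
  rw [show fnTarget f z = reg (query z) (fun i => answer z i ^^ f (query z) i) (z ∘ dE k ℓ d) from rfl,
    fnTarget_reg]
  congr 1
  funext i
  rw [Bool.xor_assoc, Bool.xor_self, Bool.xor_false]

/-- **The ideal gate of the function `f`**: the basis permutation `|q, a, g⟩ ↦ |q, a ⊕ f q, g⟩` (the XOR
query of a function, Nielsen–Chuang's `U_f`). [cite: NielsenChuang2010, §6.1.1 and §1.4.2 (U_f : |x,y⟩ ↦ |x, y ⊕ f x⟩)] -/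
def idealFn (f : QReg k → QReg ℓ) : Matrix (QReg (W k ℓ d)) (QReg (W k ℓ d)) ℂ :=
  Matrix.of fun x y => if x = fnTarget f y then 1 else 0

/-- **The ideal gate on a basis state.** [cite: NielsenChuang2010, §1.4.2] -/
theorem idealFn_mulVec_basisState (f : QReg k → QReg ℓ) (z : QReg (W k ℓ d)) :
    idealFn (d := d) f *ᵥ basisState z = basisState (fnTarget f z) := by
  funext x
  rw [Matrix.mulVec, dotProduct, Finset.sum_eq_single z]
  · rw [basisState_apply, basisState_apply, if_pos rfl, mul_one]
    rfl
  · intro y _ hy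
    rw [basisState_apply, if_neg hy, mul_zero]
  · intro h; exact absurd (Finset.mem_univ z) h

/-- The ideal gate is a basis map. [folklore] -/
theorem isBasisMap_ideal (f : QReg k → QReg ℓ) : IsBasisMap (idealFn (d := d) f) (fnTarget f) :=
  idealFn_mulVec_basisState f

/-- **The ideal gate permutes the amplitudes**: `(U_f ψ)(x) = ψ(fnTarget x)`. [folklore] -/
theorem idealFn_mulVec_apply (f : QReg k → QReg ℓ) (ψ : QReg (W k ℓ d) → ℂ) (x : QReg (W k ℓ d)) :
    (idealFn f *ᵥ ψ) x = ψ (fnTarget f x) := by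
  rw [Matrix.mulVec, dotProduct, Finset.sum_eq_single (fnTarget f x)]
  · rw [idealFn, Matrix.of_apply, if_pos (fnTarget_fnTarget f x).symm, one_mul]
  · intro y _ hy
    rw [idealFn, Matrix.of_apply, if_neg, zero_mul]
    intro h; exact hy (by rw [h, fnTarget_fnTarget])
  · intro h; exact absurd (Finset.mem_univ _) h

/-- The ideal gate preserves the norm. [folklore] -/
theorem normSq_idealFn_mulVec (f : QReg k → QReg ℓ) (ψ : QReg (W k ℓ d) → ℂ) : normSq (idealFn f *ᵥ ψ) = normSq ψ := by
  unfold normSq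
  simp_rw [idealFn_mulVec_apply]
  exact Equiv.sum_comp (Function.Involutive.toPerm (fnTarget f) (fnTarget_fnTarget f)) (fun z => ‖ψ z‖ ^ 2)

/-- The matrix of the tidy block factors as copy · `S⁻¹` · answer copy · `S` · copy. [folklore] -/
theorem tidyCirc_mat : (tidyCirc (ℓ := ℓ) S).mat = Mc k ℓ d * Vd S * Ma k ℓ d * Ud S * Mc k ℓ d := by
  change QCircuit.toMatrix 0 (⟨tidyGates S⟩ : QCircuit cliffordT (W k ℓ d)) = _
  unfold tidyGates
  rw [show (⟨revCompile (copyOps k ℓ d) ++ ((mapWires (dE k ℓ d) S).gates ++ (revCompile (ansOps k ℓ d) ++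
      ((mapWires (dE k ℓ d) S.inv).gates ++ revCompile (copyOps k ℓ d))))⟩ : QCircuit cliffordT (W k ℓ d)) =
      (⟨revCompile (copyOps k ℓ d)⟩ : QCircuit cliffordT (W k ℓ d)).append
        ((mapWires (dE k ℓ d) S).append ((⟨revCompile (ansOps k ℓ d)⟩ : QCircuit cliffordT (W k ℓ d)).append
          ((mapWires (dE k ℓ d) S.inv).append ⟨revCompile (copyOps k ℓ d)⟩))) from rfl]
  simp only [QCircuit.toMatrix_append, Matrix.mul_assoc]

/-- The copy is a basis map. [folklore] -/
theorem isBasisMap_Mc : IsBasisMap (Mc k ℓ d) (revEval (copyOps k ℓ d)) := fun z =>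
  revCompile_mulVec_basisState 0 _ z

/-- The answer copy is a basis map. [folklore] -/
theorem isBasisMap_Ma : IsBasisMap (Ma k ℓ d) (revEval (ansOps k ℓ d)) := fun z =>
  revCompile_mulVec_basisState 0 _ z

/-- **The copy on a register.** [folklore] -/
theorem Mc_mulVec_basisState (q : QReg k) (a : QReg ℓ) (f : QReg (k + d)) :
    Mc k ℓ d *ᵥ basisState (reg q a f) = basisState (reg q a fun j => f j ^^ padInput q d j) := by
  rw [isBasisMap_Mc, revEval_copyOps]

/-- The copy is an involution on registers. [folklore] -/
theorem revEval_copyOps_copyOps (z : QReg (W k ℓ d)) :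
    revEval (copyOps k ℓ d) (revEval (copyOps k ℓ d) z) = z := by
  rw [← reg_eta z, revEval_copyOps, revEval_copyOps]
  congr 1
  funext j
  rw [Bool.xor_assoc, Bool.xor_self, Bool.xor_false]

/-- The copy applied twice is the identity. [folklore] -/
theorem Mc_mulVec_Mc_mulVec (v : QReg (W k ℓ d) → ℂ) : Mc k ℓ d *ᵥ (Mc k ℓ d *ᵥ v) = v := by
  rw [Matrix.mulVec_mulVec]
  exact ((isBasisMap_Mc (k := k) (ℓ := ℓ) (d := d)).mul isBasisMap_Mc).mulVec_eq_self fun z _ =>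
    revEval_copyOps_copyOps z

/-- The copy preserves the norm. [folklore] -/
theorem normSq_Mc_mulVec (v : QReg (W k ℓ d) → ℂ) : normSq (Mc k ℓ d *ᵥ v) = normSq v :=
  normSq_mulVec_of_mem_unitaryGroup (QCircuit.toMatrix_mem_unitaryGroup_holds cliffordT_isUnitary_holds 0 _) v

/-- **The placed subroutine acts on the block factor.** [cite: NielsenChuang2010, §2.1.7 eq. (2.45)] -/
theorem Ud_mulVec_restBlockState (φ : QReg (k + d) → ℂ) (c : QReg (W k ℓ d)) :
    Ud S *ᵥ restBlockState (dE k ℓ d) φ c = restBlockState (dE k ℓ d) (S.mat *ᵥ φ) c := by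
  dsimp only [Ud]
  rw [toMatrix_mapWires, placeGate_mulVec_restBlockState]

/-- **The placed inverse subroutine acts on the block factor.** [cite: NielsenChuang2010, §2.1.7 eq. (2.45)] -/
theorem Vd_mulVec_restBlockState (φ : QReg (k + d) → ℂ) (c : QReg (W k ℓ d)) :
    Vd S *ᵥ restBlockState (dE k ℓ d) φ c = restBlockState (dE k ℓ d) (S.inv.mat *ᵥ φ) c := by
  dsimp only [Vd]
  rw [toMatrix_mapWires, placeGate_mulVec_restBlockState]

/-- A basis register as a block state over its clean rest. [folklore] -/
theorem basisState_reg_eq (q : QReg k) (a : QReg ℓ) (f g : QReg (k + d)) :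
    basisState (reg q a f) = restBlockState (dE k ℓ d) (basisState f) (reg q a g) := by
  rw [restBlockState_basisState, extend_dE_reg]

/-- **The answer copy on a block state**: the branch superposition indexed by the subroutine register,
its answer register XORed onto the answer wires.
[cite: BennettBernsteinBrassardVazirani1997, Thm. 4.14 (proof: copy the answer)] -/
theorem Ma_mulVec_restBlockState (φ : QReg (k + d) → ℂ) (q : QReg k) (a : QReg ℓ) (g : QReg (k + d)) :
    Ma k ℓ d *ᵥ restBlockState (dE k ℓ d) φ (reg q a g) = ∑ f, φ f • basisState (reg q (fun i => a i ^^ ans f i) f) := by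
  have h := (isBasisMap_Ma (k := k) (ℓ := ℓ) (d := d)).mulVec_restBlockState_of_extend (dE k ℓ d)
    (fun f c => reg (query c) (fun i => answer c i ^^ ans f i) (c ∘ dE k ℓ d)) (fun f c => by
      conv_lhs => rw [← reg_eta c, extend_dE_reg, revEval_ansOps]
      rw [extend_dE_reg]) φ (reg q a g)
  rw [h]
  refine Finset.sum_congr rfl fun f _ => ?_
  rw [query_reg, answer_reg, reg_comp_dE, extend_dE_reg]

end Pieces

/-! ### The compute–copy–uncompute computation -/

section Main

variable (fn : QReg k → QReg ℓ) (S : QCircuit cliffordT (k + d))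

/-- **The error probability of the subroutine on `q`**: the Born weight of the outputs of `S |q 0^d⟩`
(`TidyBlock.ψD`) whose answer register (`ans`, with its convention when `ℓ > k + d`) differs from `f q`.
[cite: BennettBernsteinBrassardVazirani1997, Def. 4.12 and Thm. 4.14] -/
def errFn (q : QReg k) : ℝ := ∑ g, if ans g = fn q then 0 else ‖TidyBlock.ψD S q g‖ ^ 2

/-- The error probability is nonnegative. [folklore] -/
theorem errFn_nonneg (q : QReg k) : 0 ≤ errFn fn S q := Finset.sum_nonneg fun _ _ => by
  split_ifs <;> positivity

/-- **The error on the sector of the query `q`** with answer amplitudes `c`: run–copy–reverse on the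
copied registers `Σ_a c_a |q, a, q 0^d⟩` minus the clean targets `Σ_a c_a |q, a ⊕ f q, q 0^d⟩`.
[cite: BennettBernsteinBrassardVazirani1997, Thm. 4.14 (proof)] -/
def sectorErr (q : QReg k) (c : QReg ℓ → ℂ) : QReg (W k ℓ d) → ℂ :=
  Vd S *ᵥ (Ma k ℓ d *ᵥ (Ud S *ᵥ ∑ a, c a • basisState (reg q a (padInput q d)))) -
    ∑ a, c a • basisState (reg q (fun i => a i ^^ fn q i) (padInput q d))

/-- The residual vector of answer `a'`: `ξ_{a'}(g) = ψ_S(g) (c(a' ⊕ ans g) − c(a' ⊕ f q))` (zero on the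
outputs with the right answer register). [folklore] -/
def ξ (q : QReg k) (c : QReg ℓ → ℂ) (a' : QReg ℓ) : QReg (k + d) → ℂ :=
  fun g => TidyBlock.ψD S q g * (c (fun i => a' i ^^ ans g i) - c (fun i => a' i ^^ fn q i))

/-- Summing `c a · [a' = a ⊕ v]` over `a` picks `c (a' ⊕ v)`. [folklore] -/
theorem sum_mul_ite_xor_eq (c : QReg ℓ → ℂ) (a' v : QReg ℓ) (x : ℂ) :
    ∑ a : QReg ℓ, c a * (if a' = (fun i => a i ^^ v i) then x else 0) = c (fun i => a' i ^^ v i) * x := by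
  rw [Finset.sum_eq_single (fun i => a' i ^^ v i)]
  · rw [if_pos]
    funext i
    rw [Bool.xor_assoc, Bool.xor_self, Bool.xor_false]
  · intro a _ ha
    rw [if_neg, mul_zero]
    intro h
    apply ha
    funext i
    have := congrFun h i
    change a' i = (a i ^^ v i) at this
    rw [this, Bool.xor_assoc, Bool.xor_self, Bool.xor_false]
  · intro h; exact absurd (Finset.mem_univ _) h

/-- **The sector error, amplitude by amplitude**: on the register `(q, a', h)` it is `(S⁻¹ ξ_{a'})(h)`,
and it vanishes off the sector of `q`. [cite: BennettBernsteinBrassardVazirani1997, Thm. 4.14 (proof)] -/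
theorem sectorErr_apply (q : QReg k) (c : QReg ℓ → ℂ) (z : QReg (W k ℓ d)) :
    sectorErr fn S q c z = if query z = q then (S.inv.mat *ᵥ ξ fn S q c (answer z)) (z ∘ dE k ℓ d) else 0 := by
  classical
  -- the run–copy–reverse part as a double sum of block states
  have hV : Vd S *ᵥ (Ma k ℓ d *ᵥ (Ud S *ᵥ ∑ a, c a • basisState (reg q a (padInput q d)))) =
      ∑ a, c a • ∑ g, TidyBlock.ψD S q g • restBlockState (dE k ℓ d) (S.inv.mat *ᵥ basisState g) (reg q (fun i => a i ^^ ans g i) (TidyBlock.zf k d)) := by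
    simp only [Matrix.mulVec_sum, Matrix.mulVec_smul]
    refine Finset.sum_congr rfl fun a _ => ?_
    congr 1
    rw [basisState_reg_eq q a (padInput q d) (padInput q d), Ud_mulVec_restBlockState, Ma_mulVec_restBlockState,
      Matrix.mulVec_sum]
    refine Finset.sum_congr rfl fun g _ => ?_
    rw [Matrix.mulVec_smul, basisState_reg_eq q _ g (TidyBlock.zf k d), Vd_mulVec_restBlockState]
    rfl
  -- the clean targets as the same kind of double sum
  have hI : ∑ a, c a • basisState (reg q (fun i => a i ^^ fn q i) (padInput q d)) =
      ∑ a, c a • ∑ g, TidyBlock.ψD S q g • restBlockState (dE k ℓ d) (S.inv.mat *ᵥ basisState g) (reg q (fun i => a i ^^ fn q i) (TidyBlock.zf k d)) := by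
    refine Finset.sum_congr rfl fun a _ => ?_
    congr 1
    rw [basisState_reg_eq q _ (padInput q d) (TidyBlock.zf k d), ← TidyBlock.inv_mulVec_ψD S q, TidyBlock.restBlockState_mulVec_eq_sum]
  unfold sectorErr
  rw [hV, hI, ← Finset.sum_sub_distrib]
  simp only [← smul_sub, ← Finset.sum_sub_distrib]
  -- evaluate at `z`
  simp only [Finset.sum_apply, Pi.smul_apply, Pi.sub_apply, smul_eq_mul, restBlockState_apply, agreeOff_reg_iff]
  by_cases hq : query z = q
  · simp only [hq, true_and, if_true]
    have hlin : ∀ (p : ℂ) (X Y : QReg ℓ → ℂ), ∑ a, c a * (p * (X a - Y a)) = p * ∑ a, c a * X a - p * ∑ a, c a * Y a := by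
      intro p X Y
      rw [Finset.mul_sum, Finset.mul_sum, ← Finset.sum_sub_distrib]
      exact Finset.sum_congr rfl fun a _ => by ring
    rw [Matrix.mulVec, dotProduct]
    simp_rw [Finset.mul_sum]
    rw [Finset.sum_comm]
    refine Finset.sum_congr rfl fun g _ => ?_
    rw [hlin, sum_mul_ite_xor_eq, sum_mul_ite_xor_eq]
    simp only [mulVec_basisState, ξ]
    ring
  · simp only [hq, false_and, if_false, mul_zero, sub_zero, Finset.sum_const_zero]

/-- Reindexing a sum over the answer register by a XOR. [folklore] -/
theorem sum_xor_eq (G : QReg ℓ → ℝ) (v : QReg ℓ) : ∑ a : QReg ℓ, G (fun i => a i ^^ v i) = ∑ a, G a :=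
  Equiv.sum_comp (Function.Involutive.toPerm (fun a : QReg ℓ => fun i => a i ^^ v i) fun a => by
    funext i; simp) G

/-- **The sector error has squared norm at most `4 errFn(q) ‖c‖²`.**
[cite: BennettBernsteinBrassardVazirani1997, Thm. 4.14 (proof)] -/
theorem normSq_sectorErr_le (q : QReg k) (c : QReg ℓ → ℂ) :
    normSq (sectorErr fn S q c) ≤ 4 * errFn fn S q * ∑ a, ‖c a‖ ^ 2 := by
  classical
  have hunit : S.inv.mat ∈ Matrix.unitaryGroup (QReg (k + d)) ℂ :=
    QCircuit.toMatrix_mem_unitaryGroup_holds cliffordT_isUnitary_holds 0 _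
  -- squared norm, sector by sector
  have h1 : normSq (sectorErr fn S q c) = ∑ a', normSq (S.inv.mat *ᵥ ξ fn S q c a') := by
    simp only [normSq]
    rw [sum_eq_sum_sum_sum, Finset.sum_eq_single q]
    · refine Finset.sum_congr rfl fun a' _ => Finset.sum_congr rfl fun h _ => ?_
      rw [sectorErr_apply, query_reg, if_pos rfl, answer_reg, reg_comp_dE]
    · intro q' _ hq'
      refine Finset.sum_eq_zero fun a' _ => Finset.sum_eq_zero fun h _ => ?_
      rw [sectorErr_apply, query_reg, if_neg hq']
      simp
    · intro h; exact absurd (Finset.mem_univ q) h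
  simp_rw [normSq_mulVec_of_mem_unitaryGroup hunit] at h1
  rw [h1]
  -- each residual, bounded
  have h2 : ∀ a', normSq (ξ fn S q c a') ≤ ∑ g, (if ans g = fn q then 0 else ‖TidyBlock.ψD S q g‖ ^ 2) *
      (2 * (‖c (fun i => a' i ^^ ans g i)‖ ^ 2 + ‖c (fun i => a' i ^^ fn q i)‖ ^ 2)) := by
    intro a'
    unfold normSq ξ
    refine Finset.sum_le_sum fun g _ => ?_
    by_cases hg : ans g = fn q
    · rw [hg, sub_self, mul_zero, norm_zero, if_pos rfl]
      simp
    · rw [if_neg hg, norm_mul, mul_pow]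
      exact mul_le_mul_of_nonneg_left (TidyBlock.norm_sub_sq_le _ _) (by positivity)
  refine (Finset.sum_le_sum fun a' _ => h2 a').trans ?_
  rw [Finset.sum_comm]
  have h3 : ∀ g, ∑ a' : QReg ℓ, (if ans g = fn q then (0 : ℝ) else ‖TidyBlock.ψD S q g‖ ^ 2) *
      (2 * (‖c (fun i => a' i ^^ ans g i)‖ ^ 2 + ‖c (fun i => a' i ^^ fn q i)‖ ^ 2)) =
      (if ans g = fn q then (0 : ℝ) else ‖TidyBlock.ψD S q g‖ ^ 2) * (4 * ∑ a, ‖c a‖ ^ 2) := by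
    intro g
    rw [← Finset.mul_sum]
    congr 1
    have hx := sum_xor_eq (fun a => ‖c a‖ ^ 2) (ans g)
    have hy := sum_xor_eq (fun a => ‖c a‖ ^ 2) (fn q)
    rw [← Finset.mul_sum, Finset.sum_add_distrib, hx, hy]
    ring
  simp_rw [h3]
  rw [← Finset.sum_mul]
  unfold errFn
  exact le_of_eq (by ring)

/-! ### Clean inputs and the weighted bound -/

/-- Clean inputs (every wire `≥ k + ℓ` reads `0`) are the registers `reg q a 0`. [folklore] -/
theorem clean_iff (z : QReg (W k ℓ d)) :
    (∀ i : Fin (W k ℓ d), k + ℓ ≤ (i : ℕ) → z i = false) ↔ z ∘ dE k ℓ d = TidyBlock.zf k d := by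
  constructor
  · intro h
    funext j
    exact h _ (by rw [val_dE]; omega)
  · intro h i hi
    obtain ⟨j, rfl⟩ : ∃ j : Fin (k + d), i = dE k ℓ d j :=
      ⟨⟨(i : ℕ) - (k + ℓ), by have h2 : (i : ℕ) < k + ℓ + (k + d) := i.isLt; omega⟩,
        Fin.ext (by rw [val_dE]; simp only; omega)⟩
    exact congrFun h j

/-- **The weight of the query `q`** in a state of the tidy register: `Σ_a |ψ(q, a, 0…0)|²`. [folklore] -/
def queryWeight (ψ : QReg (W k ℓ d) → ℂ) (q : QReg k) : ℝ := ∑ a : QReg ℓ, ‖ψ (reg q a (TidyBlock.zf k d))‖ ^ 2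

/-- Query weights are nonnegative. [folklore] -/
theorem queryWeight_nonneg (ψ : QReg (W k ℓ d) → ℂ) (q : QReg k) : 0 ≤ queryWeight ψ q :=
  Finset.sum_nonneg fun _ _ => by positivity

/-- **The function-valued form of BBBV's Theorem 4.14, weighted.** On a clean input `ψ` (every wire
`≥ k + ℓ` reads `0`) the tidy block around `S` differs from the ideal gate `U_f` by a vector of squared
norm at most `4 Σ_q errFn(q) · w_ψ(q)`. [cite: BennettBernsteinBrassardVazirani1997, Thm. 4.14 (proof)] -/
theorem normSq_tidyCirc_sub_idealFn_le (ψ : QReg (W k ℓ d) → ℂ)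
    (hψ : SuppIn {z : QReg (W k ℓ d) | ∀ i : Fin (W k ℓ d), k + ℓ ≤ (i : ℕ) → z i = false} ψ) :
    normSq ((tidyCirc S).mat *ᵥ ψ - idealFn fn *ᵥ ψ) ≤ 4 * ∑ q, errFn fn S q * queryWeight ψ q := by
  classical
  have hψ0 : ∀ z, z ∘ dE k ℓ d ≠ TidyBlock.zf k d → ψ z = 0 := fun z hz => hψ z fun h => hz ((clean_iff z).1 h)
  -- coefficients and decomposition of the clean input
  set c : QReg k → QReg ℓ → ℂ := fun q a => ψ (reg q a (TidyBlock.zf k d)) with hc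
  have hdec : ψ = ∑ q, ∑ a, c q a • basisState (reg q a (TidyBlock.zf k d)) := by
    conv_lhs => rw [state_eq_sum_smul_basisState ψ, sum_eq_sum_sum_sum]
    refine Finset.sum_congr rfl fun q _ => Finset.sum_congr rfl fun a _ => ?_
    rw [Finset.sum_eq_single (TidyBlock.zf k d)]
    · intro f _ hf
      rw [hψ0 _ (by rw [reg_comp_dE]; exact hf), zero_smul]
    · intro h; exact absurd (Finset.mem_univ _) h
  -- the copied input and the ideal output
  have hcopy : Mc k ℓ d *ᵥ ψ = ∑ q, ∑ a, c q a • basisState (reg q a (padInput q d)) := by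
    conv_lhs => rw [hdec]
    simp only [Matrix.mulVec_sum, Matrix.mulVec_smul, Mc_mulVec_basisState, TidyBlock.zf_apply, Bool.false_xor]
  have hideal : idealFn fn *ᵥ ψ = Mc k ℓ d *ᵥ ∑ q, ∑ a, c q a • basisState (reg q (fun i => a i ^^ fn q i) (padInput q d)) := by
    conv_lhs => rw [hdec]
    simp only [Matrix.mulVec_sum, Matrix.mulVec_smul, idealFn_mulVec_basisState, fnTarget_reg, Mc_mulVec_basisState,
      Bool.xor_self, show (TidyBlock.zf k d : QReg (k + d)) = fun _ => false from rfl]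
  -- the error vector
  have herr : (tidyCirc S).mat *ᵥ ψ - idealFn fn *ᵥ ψ = Mc k ℓ d *ᵥ ∑ q, sectorErr fn S q (c q) := by
    have h1 : (tidyCirc S).mat *ᵥ ψ = Mc k ℓ d *ᵥ (Vd S *ᵥ (Ma k ℓ d *ᵥ (Ud S *ᵥ (Mc k ℓ d *ᵥ ψ)))) := by
      simp only [tidyCirc_mat, ← Matrix.mulVec_mulVec]
    rw [h1, hideal, ← Matrix.mulVec_sub, hcopy]
    congr 1
    simp only [sectorErr, Matrix.mulVec_sum, Matrix.mulVec_smul, Finset.sum_sub_distrib]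
  rw [herr, normSq_Mc_mulVec, TidyBlock.normSq_sum_of_disjoint]
  · rw [Finset.mul_sum]
    refine Finset.sum_le_sum fun q _ => ?_
    have h := normSq_sectorErr_le fn S q (c q)
    have e : ∑ a, ‖c q a‖ ^ 2 = queryWeight ψ q := rfl
    rw [e] at h
    linarith
  · intro q q' z hqq
    by_cases hz : query z = q
    · right
      rw [sectorErr_apply, if_neg (fun h => hqq (hz.symm.trans h))]
    · left
      rw [sectorErr_apply, if_neg hz]

end Main

end TidyBlockFn

end Literature.Computability.QuantumComplexity

end
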